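import Mathlib
import Literature.Probability.LatticeModels.GKSInequalities
import Summits.CriticalPhenomena.Ising3DConformalLimit.Theorems.PrecisionLaplacianInverseMFerromagnetRowDegLeTwo
import Summits.CriticalPhenomena.Ising3DConformalLimit.Theorems.PrecisionLaplacianInverseMFerromagnetLevelLeOne
import HarnessLib

/-!
# Crux `PrecisionLaplacian.InverseMFerromagnet` (stmt-CriticalPhenomena-4798), line `Sketch` —
# stub `helper_db_deg2_eq` (core D, series–parallel programme D6: DB♯ is an equality at degree ≤ 2)

THEOREM-ONLY file (no definitions).  Let `Σ = (⟨σ_pσ_q⟩)_{p,q}` be the spin second-moment matrix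
of the zero-field pair ferromagnet `gksExpect univ K C` on `Fin n` (`K ≥ 0`, `|C i| = 2`), and let
`x, x', y` be pairwise distinct sites such that every bond containing `x` is `{x,x'}` or `{x,y}`.
With `κ = ∑_{i : C i = {x,y}} K_i`, `t = tanh κ`, `G = ⟨σ_xσ_y⟩` we prove the EQUALITY case of the
dressed Bethe edge bound DB♯: `(Σ⁻¹)_xy = −t/(1 + t² − 2tG)`.

Proof ("integrate out `σ_x`", as in `…RowDegLeTwo.lean`).  Put `κ' = ∑_{i : C i = {x,x'}} K_i`.
The local field at `x` is `h_x = κ'σ_{x'} + κσ_y`, so by Callen's identity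
(`c3_gksExpect_spin_eq_tanh`) `⟨σ_x F⟩ = ⟨tanh(h_x) F⟩ = α⟨σ_{x'}F⟩ + β⟨σ_yF⟩` for every `F`
invariant under the flip at `x`, where `tanh(κ's' + κs) = αs' + βs` on `{±1}²`,
`α = (tanh(κ'+κ) + tanh(κ'−κ))/2`, `β = (tanh(κ'+κ) − tanh(κ'−κ))/2` (`d6_tanh_two_spins`).
Hence `w = e_x − αe_{x'} − βe_y` has `wᵀΣ = V e_xᵀ` with `V = 1 − αΣ_{xx'} − βΣ_{xy} > 0`
(`Σ` is positive definite, `c3_posDef`), row `x` of `Σ⁻¹` is `w/V` and `(Σ⁻¹)_xy = −β/V`.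
Callen with `F = σ_{x'}`, `F = σ_y` gives `Σ_{xx'} = α + βΣ_{x'y}`, `Σ_{xy} = αΣ_{x'y} + β`, so
`β(1 + t² − 2tG) − tV = β(1+t²) − t(1 − α² + β²)`, which vanishes identically
(`d6_tanh_identity`: with `t' = tanh κ'`, `α = t'(1−t²)/(1−t'²t²)`, `β = t(1−t'²)/(1−t'²t²)`).
-/

namespace Summit.CriticalPhenomena.Ising3DConformalLimit.Cruxes.InverseMFerromagnet.PartialCovarianceLadder

open Literature.Probability.LatticeModels Finset Matrix

/-! ## Scalar identities -/

/-- `tanh z = ((e^z)² − 1)/((e^z)² + 1)`. [folklore] -/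
theorem d6_tanh_eq_exp_sq (z : ℝ) :
    Real.tanh z = (Real.exp z ^ 2 - 1) / (Real.exp z ^ 2 + 1) := by
  -- adapted from Theorems/PrecisionLaplacianInverseMFerromagnetDbOfIm.lean (`db_tanh_eq`)
  have h1 : Real.exp z * Real.exp (-z) = 1 := by
    rw [← Real.exp_add, add_neg_cancel, Real.exp_zero]
  rw [Real.tanh_eq_sinh_div_cosh, Real.sinh_eq, Real.cosh_eq]
  field_simp
  linear_combination (-(2 : ℝ) * Real.exp z) * h1

/-- The `tanh` identity behind the equality case of DB♯ at a degree-two site: with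
`α = (tanh(a+b) + tanh(a−b))/2`, `β = (tanh(a+b) − tanh(a−b))/2`, `t = tanh b` one has
`β(1 + t²) = t(1 − α² + β²)` (in the variables `t' = tanh a`, `t`: `α = t'(1−t²)/(1−t'²t²)`,
`β = t(1−t'²)/(1−t'²t²)`, and `(1−t'²)(1+t²)(1−t'²t²) = (1−t'²t²)² − t'²(1−t²)² + t²(1−t'²)²`).
[folklore] -/
theorem d6_tanh_identity (a b α β : ℝ)
    (hα : α = (Real.tanh (a + b) + Real.tanh (a - b)) / 2)
    (hβ : β = (Real.tanh (a + b) - Real.tanh (a - b)) / 2) :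
    β * (1 + Real.tanh b ^ 2) = Real.tanh b * (1 - α ^ 2 + β ^ 2) := by
  have hP : 0 < Real.exp a := Real.exp_pos a
  have hQ : 0 < Real.exp b := Real.exp_pos b
  rw [hα, hβ, d6_tanh_eq_exp_sq (a + b), d6_tanh_eq_exp_sq (a - b), d6_tanh_eq_exp_sq b,
    Real.exp_add, Real.exp_sub]
  have h1 : (Real.exp a * Real.exp b) ^ 2 + 1 ≠ 0 := by positivity
  have h2 : (Real.exp a / Real.exp b) ^ 2 + 1 ≠ 0 := by positivity
  have h3 : Real.exp b ^ 2 + 1 ≠ 0 := by positivity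
  field_simp
  ring

/-- `tanh` of a combination of two `±1` spins is linear in them:
`tanh(a s' + b s) = αs' + βs` with `α = (tanh(a+b) + tanh(a−b))/2`, `β = (tanh(a+b) − tanh(a−b))/2`.
[folklore] -/
theorem d6_tanh_two_spins (a b s' s : ℝ) (hs' : s' = 1 ∨ s' = -1) (hs : s = 1 ∨ s = -1) :
    Real.tanh (a * s' + b * s)
      = (Real.tanh (a + b) + Real.tanh (a - b)) / 2 * s'
        + (Real.tanh (a + b) - Real.tanh (a - b)) / 2 * s := by
  rcases hs' with rfl | rfl <;> rcases hs with rfl | rfl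
  · rw [show a * 1 + b * 1 = a + b by ring]; ring
  · rw [show a * 1 + b * -1 = a - b by ring]; ring
  · rw [show a * -1 + b * 1 = -(a - b) by ring, Real.tanh_neg]; ring
  · rw [show a * -1 + b * -1 = -(a + b) by ring, Real.tanh_neg]; ring

/-- Linearity of `gksExpect` on two terms. [folklore] -/
theorem d6_gksExpect_lin {Λ ι : Type*} [Fintype Λ] [DecidableEq Λ] (s : Finset ι) (K : ι → ℝ)
    (C : ι → Finset Λ) (a b : ℝ) (f g : SpinConfig Λ → ℝ) :
    gksExpect s K C (fun ω => a * f ω + b * g ω)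
      = a * gksExpect s K C f + b * gksExpect s K C g := by
  simp only [gksExpect, gksSum, add_mul, Finset.sum_add_distrib, mul_assoc, ← Finset.mul_sum,
    add_div, mul_div_assoc]

/-! ## The registered stub -/

/-- Registered stub `helper_db_deg2_eq` (core D, D6 of line `Sketch`): for the spin second-moment
matrix `Σ = (⟨σ_pσ_q⟩)` of a zero-field pair ferromagnet (`K ≥ 0`, `|C i| = 2`), if every bond at
`x` is `{x,x'}` or `{x,y}` (`x, x', y` pairwise distinct) then, with `κ = ∑_{i : C i = {x,y}} K_i`,
`t = tanh κ`, `G = ⟨σ_xσ_y⟩`: `(Σ⁻¹)_xy = −t/(1 + t² − 2tG)` — the dressed Bethe edge bound DB♯ is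
an equality at sites of degree `≤ 2`.  Row `x` of `Σ⁻¹` is `(e_x − αe_{x'} − βe_y)/V` by Callen's
identity, and `β/V = t/(1 + t² − 2tG)` is the identity `d6_tanh_identity`. [folklore] -/
theorem helper_db_deg2_eq :
    ∀ (n m : ℕ) (K : Fin m → ℝ) (C : Fin m → Finset (Fin n)), (∀ i, 0 ≤ K i) → (∀ i, (C i).card = 2) →
      ∀ x x' y : Fin n, x ≠ y → x ≠ x' → x' ≠ y →
        (∀ i, x ∈ C i → (C i = {x, x'} ∨ C i = {x, y})) →
        (Matrix.of fun p q : Fin n => gksExpect Finset.univ K C (fun ω => spinAt p ω * spinAt q ω))⁻¹ x y =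
          -(Real.tanh (∑ i ∈ Finset.univ.filter (fun i => C i = {x, y}), K i)) /
            (1 + Real.tanh (∑ i ∈ Finset.univ.filter (fun i => C i = {x, y}), K i) ^ 2
              - 2 * Real.tanh (∑ i ∈ Finset.univ.filter (fun i => C i = {x, y}), K i)
                * gksExpect Finset.univ K C (fun ω => spinAt x ω * spinAt y ω)) := by
  intro n m K C _hK _hC x x' y hxy hxx' hx'y hbond
  -- the two couplings at `x`
  obtain ⟨κ, hκ⟩ : ∃ κ : ℝ, (∑ i ∈ Finset.univ.filter (fun i => C i = {x, y}), K i) = κ :=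
    ⟨_, rfl⟩
  obtain ⟨κ', hκ'⟩ : ∃ κ' : ℝ, (∑ i ∈ Finset.univ.filter (fun i => C i = {x, x'}), K i) = κ' :=
    ⟨_, rfl⟩
  rw [hκ]
  -- `{x, x'} ≠ {x, y}`
  have hpair : ({x, x'} : Finset (Fin n)) ≠ {x, y} := by
    intro heq
    have hm : x' ∈ ({x, y} : Finset (Fin n)) := by
      rw [← heq]
      simp
    simp only [Finset.mem_insert, Finset.mem_singleton] at hm
    rcases hm with h | h
    · exact hxx' h.symm
    · exact hx'y h
  -- the partner `u i ∈ {x', y}` of `x` in each bond `C i ∋ x`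
  obtain ⟨u, hudef⟩ : ∃ u : Fin m → Fin n, ∀ i, u i = if C i = {x, y} then y else x' :=
    ⟨_, fun _ => rfl⟩
  have huz : ∀ i, u i ≠ x := fun i => by
    rw [hudef]
    split_ifs
    · exact hxy.symm
    · exact hxx'.symm
  have hu : ∀ i, x ∈ C i → C i = {x, u i} := fun i hi => by
    rcases hbond i hi with h | h
    · rw [hudef, if_neg (by rw [h]; exact hpair)]
      exact h
    · rw [hudef, if_pos h]
      exact h
  obtain ⟨I, hIdef⟩ : ∃ I : Finset (Fin m), I = Finset.univ.filter (fun i => x ∈ C i) := ⟨_, rfl⟩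
  have hI : ∀ i, i ∈ I ↔ x ∈ C i := fun i => by simp [hIdef]
  -- the local field at `x`: `h_x = κ' σ_{x'} + κ σ_y`
  have hfield : ∀ ω : SpinConfig (Fin n),
      ∑ i ∈ I, K i * spinAt (u i) ω = κ' * spinAt x' ω + κ * spinAt y ω := by
    intro ω
    have h1 : ∀ i ∈ I, K i * spinAt (u i) ω
        = if C i = {x, y} then K i * spinAt y ω else K i * spinAt x' ω := by
      intro i _
      rw [hudef]
      split_ifs <;> rfl
    rw [Finset.sum_congr rfl h1, Finset.sum_ite, ← Finset.sum_mul, ← Finset.sum_mul]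
    have hf1 : I.filter (fun i => C i = {x, y}) = Finset.univ.filter (fun i => C i = {x, y}) := by
      ext i
      simp only [Finset.mem_filter, Finset.mem_univ, true_and, hI]
      constructor
      · exact fun h => h.2
      · intro h
        refine ⟨?_, h⟩
        rw [h]
        simp
    have hf2 : I.filter (fun i => ¬ C i = {x, y})
        = Finset.univ.filter (fun i => C i = {x, x'}) := by
      ext i
      simp only [Finset.mem_filter, Finset.mem_univ, true_and, hI]
      constructor
      · rintro ⟨h1, h2⟩
        rcases hbond i h1 with h | h
        · exact h
        · exact absurd h h2
      · intro h
        refine ⟨?_, ?_⟩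
        · rw [h]
          simp
        · rw [h]
          exact hpair
    rw [hf1, hf2, hκ, hκ']
    ring
  -- the flip at `x` and the linearised `tanh` of the local field
  obtain ⟨φ, hφ⟩ : ∃ φ : SpinConfig (Fin n) → SpinConfig (Fin n),
      ∀ ω p, φ ω p = if p = x then -ω p else ω p :=
    ⟨fun ω p => if p = x then -ω p else ω p, fun _ _ => rfl⟩
  obtain ⟨α, hα⟩ : ∃ α : ℝ, α = (Real.tanh (κ' + κ) + Real.tanh (κ' - κ)) / 2 := ⟨_, rfl⟩
  obtain ⟨β, hβ⟩ : ∃ β : ℝ, β = (Real.tanh (κ' + κ) - Real.tanh (κ' - κ)) / 2 := ⟨_, rfl⟩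
  have hT : ∀ ω : SpinConfig (Fin n),
      Real.tanh (∑ i ∈ I, K i * spinAt (u i) ω) = α * spinAt x' ω + β * spinAt y ω := by
    intro ω
    rw [hfield ω, d6_tanh_two_spins κ' κ _ _ (spinAt_eq_one_or_eq_neg_one x' ω)
      (spinAt_eq_one_or_eq_neg_one y ω), hα, hβ]
  set A : Matrix (Fin n) (Fin n) ℝ :=
    Matrix.of (fun p q : Fin n => gksExpect Finset.univ K C (fun ω => spinAt p ω * spinAt q ω))
    with hA
  have hsymm : ∀ p q, A p q = A q p := fun p q => by
    simp only [hA, Matrix.of_apply]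
    exact congrArg _ (funext fun ω => mul_comm _ _)
  have hdiag : ∀ p, A p p = 1 := fun p => by
    simp only [hA, Matrix.of_apply]
    exact gksExpect_pair_self n m K C p
  -- Callen: `Σ_xq = α Σ_{x'q} + β Σ_{yq}` for `q ≠ x`
  have hkey : ∀ q, q ≠ x → A x q = α * A x' q + β * A y q := by
    intro q hq
    have h1 := c3_gksExpect_spin_eq_tanh K C x φ hφ I hI u hu huz (spinAt q)
      (fun ω => by rw [c3_spinAt_flip x φ hφ, if_neg hq])
    have h2 : (fun ω => Real.tanh (∑ i ∈ I, K i * spinAt (u i) ω) * spinAt q ω)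
        = fun ω => α * (spinAt x' ω * spinAt q ω) + β * (spinAt y ω * spinAt q ω) := by
      funext ω
      rw [hT ω]
      ring
    rw [h2, d6_gksExpect_lin] at h1
    simpa only [hA, Matrix.of_apply] using h1
  -- linear algebra on the positive definite matrix `A`
  have hPD : A.PosDef := c3_posDef Finset.univ K C
  have hdet : IsUnit A.det := (Matrix.isUnit_iff_isUnit_det A).mp hPD.isUnit
  obtain ⟨w, hw⟩ : ∃ w : Fin n → ℝ, ∀ p, w p
      = (if p = x then (1 : ℝ) else 0) - α * (if p = x' then 1 else 0)
          - β * (if p = y then 1 else 0) :=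
    ⟨_, fun _ => rfl⟩
  have hwsum : ∀ f : Fin n → ℝ, ∑ p, w p * f p = f x - α * f x' - β * f y := by
    intro f
    have h1 : ∀ p, w p * f p = (if p = x then f p else 0) - α * (if p = x' then f p else 0)
        - β * (if p = y then f p else 0) := by
      intro p
      rw [hw]
      split_ifs <;> ring
    simp_rw [h1]
    rw [Finset.sum_sub_distrib, Finset.sum_sub_distrib, ← Finset.mul_sum, ← Finset.mul_sum,
      Finset.sum_ite_eq', Finset.sum_ite_eq', Finset.sum_ite_eq']
    simp
  have hwA : ∀ q, q ≠ x → (w ᵥ* A) q = 0 := by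
    intro q hq
    simp only [Matrix.vecMul, dotProduct]
    rw [hwsum (fun p => A p q), hkey q hq]
    ring
  obtain ⟨V, hV⟩ : ∃ V : ℝ, V = (w ᵥ* A) x := ⟨_, rfl⟩
  have hvec : w ᵥ* A = Pi.single x V := by
    funext q
    by_cases hq : q = x
    · rw [hq, Pi.single_eq_same, hV]
    · rw [Pi.single_eq_of_ne hq, hwA q hq]
  have hwq : ∀ q, w q = V * A⁻¹ x q := by
    have h : w = V • A⁻¹ x := by
      calc w = (w ᵥ* A) ᵥ* A⁻¹ := by
            rw [Matrix.vecMul_vecMul, Matrix.mul_nonsing_inv A hdet, Matrix.vecMul_one]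
        _ = V • A⁻¹ x := by rw [hvec, Matrix.single_vecMul]; rfl
    intro q
    have hq' := congrFun h q
    simpa only [Pi.smul_apply, smul_eq_mul] using hq'
  have hwx : w x = 1 := by
    rw [hw, if_pos rfl, if_neg hxx', if_neg hxy]
    ring
  have hwy : w y = -β := by
    rw [hw, if_neg hxy.symm, if_neg hx'y.symm, if_pos rfl]
    ring
  have hVpos : 0 < V := by
    have h1 : 0 < V * A⁻¹ x x := by rw [← hwq x, hwx]; exact one_pos
    exact pos_of_mul_pos_left h1 hPD.inv.diag_pos.le
  have hinv : A⁻¹ x y = -β / V := by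
    rw [eq_div_iff hVpos.ne', mul_comm, ← hwq y, hwy]
  -- eliminating the other correlations
  have hVeq : V = 1 - α * A x x' - β * A x y := by
    rw [hV]
    simp only [Matrix.vecMul, dotProduct]
    rw [hwsum (fun p => A p x), hdiag x, hsymm x' x, hsymm y x]
  have hGxx' : A x x' = α + β * A x' y := by
    rw [hkey x' hxx'.symm, hdiag x', hsymm y x']
    ring
  have hGxy : A x y = α * A x' y + β := by
    rw [hkey y hxy.symm, hdiag y]
    ring
  have hid : β * (1 + Real.tanh κ ^ 2) = Real.tanh κ * (1 - α ^ 2 + β ^ 2) :=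
    d6_tanh_identity κ' κ α β hα hβ
  have hcross : β * (1 + Real.tanh κ ^ 2 - 2 * Real.tanh κ * A x y) = Real.tanh κ * V := by
    rw [hVeq, hGxx', hGxy]
    linear_combination hid
  -- conclusion
  have hAxy : A x y = gksExpect Finset.univ K C (fun ω => spinAt x ω * spinAt y ω) := rfl
  rw [← hAxy, hinv]
  by_cases hD : 1 + Real.tanh κ ^ 2 - 2 * Real.tanh κ * A x y = 0
  · -- degenerate normalisation of `x/0`: then `tV = 0`, so `t = 0` and `β = 0`
    have ht : Real.tanh κ = 0 := by
      have h1 : Real.tanh κ * V = 0 := by rw [← hcross, hD, mul_zero]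
      rcases mul_eq_zero.1 h1 with h | h
      · exact h
      · exact absurd h hVpos.ne'
    have hb : β = 0 := by
      have h1 := hid
      rw [ht] at h1
      simpa using h1
    rw [hD, ht, hb]
    simp
  · rw [div_eq_div_iff hVpos.ne' hD]
    linear_combination (-1 : ℝ) * hcross

end Summit.CriticalPhenomena.Ising3DConformalLimit.Cruxes.InverseMFerromagnet.PartialCovarianceLadder
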